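/-
Copyright (c) 2026 the pub-hodgecm-mathlib formalisation cell (harness21).  Prover seat hodgecm-mathlib-A-p19 (g24) — (U) road, U4-DISCHARGE assembly shape, 2026-09-01.
-/
import Summits.HodgeConjecture.HodgeConjecture.Theorems.F0P3ArchTopFormWallCompatible   -- ★ p844462 U4 `ArchTopFormWallCompatible` (+ ★ U5 §1, ★ U1′)
import Literature.NumberTheory.Weil1964.UnitaryArchLocalTopFormMassUniversal                  -- ★ p844742 (ED. 2): `blockMass_two_of_massEqSource`, `blockMass_one_of_massEqSource`
import HarnessLib

/-!
# (U) ROAD, U4-DISCHARGE — THE ASSEMBLY SHAPE: `ArchTopFormWallCompatible L` from THREE place-local inputs — (W1a) the compact rank-2 block mass is ONE `V₂`, (W1b) the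
# rank-1 block mass is ONE `V₁`, (W2) the (J-nc) constant of the top-form wall-block measure is `−V₂·V₁` (LEAD F0P3a-plan (g10) WORD T9-40 deals (d1) A-p12 (b3), (d2)
# F0P3-p03 (cpt-transport), p07 (b2); owner A-p19 (g24))

Cell `pub/hodgecm-mathlib`, F0∕P3a, crux H413 (`stmt-HodgeConjecture-24833`, `--supports … --as helper`); namespace
`Summit.HodgeConjecture.HodgeConjecture.Cruxes.H413.F0P3ArchTopFormWallCompatibleOfBlocks`.  ONE THEOREM (kernel lane); no def, no `sorry`.  HONEST LABEL: HC_CM is proved only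
modulo the 2 remaining named inputs (hLiu418, h413) until rung 0 closes; `ArchTopFormWallCompatible` (the last in-house statement under the «(U)» books row) is NOT proved here —
this file fixes the TOKENS of the three bricks that prove it and composes them.

THE THREE INPUTS (binders below; each is a place-local statement about ★ U1 `archLocalTopFormHaar` only):
* (W1a) `hV₂ : ∀ w (b : Fin 2 → L) real non-zero with re σ(b 0) · re σ(b 1) > 0, archLocalTopFormHaar L 2 (diagonal b) w univ = V₂` — the top-form mass of the COMPACT `U(σ_w diag b)(ℂ) ≅ U(2)`
  is ONE number (all definite complex hermitian forms of rank 2 are congruent to `±1₂`, and `U(−J) = U(J)`: local congruence transport of ★ `localTopFormHaar` = F0P3-p03 (d2) ★-to-be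
  `UnitaryArchLocalSkewCongr` + A-p06 (g29)'s local any-window identity; the VALUE of `V₂` (A-p12 (d1), (b3), Weyl∕polar on `U(2)`) is NOT needed — only its universality and `V₂ ≠ 0`);
* (W1b) `hV₁ : ∀ w (x : L) real non-zero, archLocalTopFormHaar L 1 (diagonal ![x]) w univ = V₁` — the mass of `U(1)` (the rank-one circle case; `V₁ = π` in the Cayley∕trace-form
  normalisation, but again only universality is used);
* (W2) `hnc : ‹★ U4's (nc) conjunct VERBATIM with constant −(V₂·V₁)›` — THE VALUE STATEMENT proper (CENSUS-Jval (b2): the Harish-Chandra constant of the top-form wall-block measure at a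
  noncompact wall, through ★ (d2′)(d3a)(HAT-BOX)(R1G) with explicit constants, compared with `V₂·V₁`; p07 (b2) first refusal; L).
THE COMPOSITION: `V := V₂·V₁`; (cpt) = mass of `θ^TF_w(β) = (μ^TF_2 ⊗ μ^TF_1)_* ι_w` = `μ^TF_2(univ) · μ^TF_1(univ)` (push-forward and product on `univ`) = `V₂·V₁` by (W1a) at `b := (β₀, β₂)`
and (W1b) at `x := β₁`; (nc) = (W2).
* **`archTopFormWallCompatible_of_blockMasses_of_clause (V₂ V₁ : ℝ≥0) (hV₂ : V₂ ≠ 0) (hV₁ : V₁ ≠ 0) (hm₂) (hm₁) (hnc) : ArchTopFormWallCompatible L`**.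
-/

set_option autoImplicit false
set_option linter.dupNamespace false

noncomputable section

open MeasureTheory Measure Set Filter Topology NumberField NumberField.InfinitePlace NumberField.mixedEmbedding Matrix Equiv
open Literature.MeasureTheory.Group Literature.NumberTheory.Automorphic Literature.NumberTheory.Automorphic.UnitaryGroup
open Literature.NumberTheory.Weil1964 Literature.NumberTheory.Weil1964.UnitaryArchTopForm Literature.NumberTheory.Weil1964.UnitaryArchLocalTopForm
open Literature.NumberTheory.Rogawski1990
open Summit.HodgeConjecture.HodgeConjecture.Cruxes.H413.F0P3ArchTopFormWallCompatible
open scoped ENNReal NNReal Classical Matrix MatrixGroups Matrix.Norms.Operator ContDiff ComplexConjugate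

namespace Summit.HodgeConjecture.HodgeConjecture.Cruxes.H413.F0P3ArchTopFormWallCompatibleOfBlocks

set_option maxHeartbeats 800000 in
/-- **U4 FROM THREE PLACE-LOCAL INPUTS**: universality of the compact rank-2 top-form mass (`V₂`), of the rank-1 mass (`V₁`), and the (J-nc) constant `−V₂·V₁` of the top-form wall-block
measure ⟹ `ArchTopFormWallCompatible L` with `V := V₂·V₁`.  (The (cpt) conjunct is the mass of a push-forward of a product measure; the (nc) conjunct is the third input verbatim.)
(in-house plumbing; motivated by Rogawski 1990 §8.2 p. 119, §1.7 p. 6) -/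
theorem archTopFormWallCompatible_of_blockMasses_of_clause (L : Type) [Field L] [NumberField L] [IsCMField L] (V₂ V₁ : ℝ≥0) (hV₂ : V₂ ≠ 0) (hV₁ : V₁ ≠ 0)
    (hm₂ : ∀ [MeasurableSpace (GL (Fin 2) ℂ)] [BorelSpace (GL (Fin 2) ℂ)] (w : {w : InfinitePlace L // IsComplex w}) (b : Fin 2 → L) (_hb : ∀ i, b i ≠ 0)
      (_hbr : ∀ i, (IsCMField.complexConj L (b i) : L) = b i), 0 < (w.1.embedding (b 0)).re * (w.1.embedding (b 1)).re →
      archLocalTopFormHaar L 2 (Matrix.diagonal b) w Set.univ = V₂)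
    (hm₁ : ∀ [MeasurableSpace (GL (Fin 1) ℂ)] [BorelSpace (GL (Fin 1) ℂ)] (w : {w : InfinitePlace L // IsComplex w}) (x : L) (_hx : x ≠ 0) (_hxr : (IsCMField.complexConj L x : L) = x),
      archLocalTopFormHaar L 1 (Matrix.diagonal ![x]) w Set.univ = V₁)
    (hnc : (∀ [MeasurableSpace (GL (Fin 2) ℂ)] [BorelSpace (GL (Fin 2) ℂ)] [MeasurableSpace (GL (Fin 1) ℂ)] [BorelSpace (GL (Fin 1) ℂ)]
      [MeasurableSpace (GL (Fin 3) ℂ)] [BorelSpace (GL (Fin 3) ℂ)]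
      (w : {w : InfinitePlace L // IsComplex w}) (β : Fin 3 → L) (hβ : ∀ i, β i ≠ 0) (hhermβ : ∀ i, (IsCMField.complexConj L (β i) : L) = β i)
      (z₁ : Fin 3 → Circle) (h02 : z₁ 0 = z₁ 2) (h01 : z₁ 0 ≠ z₁ 1)
      [MeasurableSpace (archLocal L 3 (Matrix.diagonal β) w ⧸ Subgroup.centralizer ({(⟨circleDiagonal 3 z₁, circleDiagonal_mem_archLocal_diagonal L 3 β w z₁⟩ : archLocal L 3 (Matrix.diagonal β) w)} : Set (archLocal L 3 (Matrix.diagonal β) w)))] [BorelSpace (archLocal L 3 (Matrix.diagonal β) w ⧸ Subgroup.centralizer ({(⟨circleDiagonal 3 z₁, circleDiagonal_mem_archLocal_diagonal L 3 β w z₁⟩ : archLocal L 3 (Matrix.diagonal β) w)} : Set (archLocal L 3 (Matrix.diagonal β) w)))],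
      (w.1.embedding (β 0)).re * (w.1.embedding (β 2)).re < 0 →
      haveI : LocallyCompactSpace (archLocal L 3 (Matrix.diagonal β) w) := locallyCompactSpace_archLocal L 3 (Matrix.diagonal β) w
      haveI : SecondCountableTopology (archLocal L 3 (Matrix.diagonal β) w) := secondCountableTopology_archLocal L 3 (Matrix.diagonal β) w
      haveI : (archLocalTopFormHaar L 2 (Matrix.diagonal ![β 0, β 2]) w).IsHaarMeasure := isHaarMeasure_archLocalTopFormHaar_diagonal L 2 w ![β 0, β 2] (fun i => by fin_cases i <;> simp [hβ]) (fun i => by fin_cases i <;> simp [hhermβ])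
      haveI : (archLocalTopFormHaar L 1 (Matrix.diagonal ![β 1]) w).IsHaarMeasure := isHaarMeasure_archLocalTopFormHaar_diagonal L 1 w ![β 1] (fun i => by fin_cases i; simp [hβ]) (fun i => by fin_cases i; simp [hhermβ])
      haveI : (Measure.map (fun p : ↥(archLocal L 2 (Matrix.diagonal ![β 0, β 2]) w) × ↥(archLocal L 1 (Matrix.diagonal ![β 1]) w) =>
            (⟨endoEmb (starRingEnd ℂ) ((Matrix.diagonal ![β 0, β 2]).map w.1.embedding) ((Matrix.diagonal ![β 1]).map w.1.embedding)
                ((Matrix.diagonal β).map w.1.embedding) (endoForm_archLocal_diagonal L β w) p,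
              endoEmb_mem_centralizer_circleDiagonal L β w h02 p⟩ : ↥(Subgroup.centralizer ({(⟨circleDiagonal 3 z₁, circleDiagonal_mem_archLocal_diagonal L 3 β w z₁⟩ : archLocal L 3 (Matrix.diagonal β) w)} : Set (archLocal L 3 (Matrix.diagonal β) w)))))
          ((archLocalTopFormHaar L 2 (Matrix.diagonal ![β 0, β 2]) w).prod (archLocalTopFormHaar L 1 (Matrix.diagonal ![β 1]) w))).IsHaarMeasure := isHaarMeasure_wallBlockMap L β w h02 h01 _ _
      haveI : (Measure.map (fun p : ↥(archLocal L 2 (Matrix.diagonal ![β 0, β 2]) w) × ↥(archLocal L 1 (Matrix.diagonal ![β 1]) w) =>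
            (⟨endoEmb (starRingEnd ℂ) ((Matrix.diagonal ![β 0, β 2]).map w.1.embedding) ((Matrix.diagonal ![β 1]).map w.1.embedding)
                ((Matrix.diagonal β).map w.1.embedding) (endoForm_archLocal_diagonal L β w) p,
              endoEmb_mem_centralizer_circleDiagonal L β w h02 p⟩ : ↥(Subgroup.centralizer ({(⟨circleDiagonal 3 z₁, circleDiagonal_mem_archLocal_diagonal L 3 β w z₁⟩ : archLocal L 3 (Matrix.diagonal β) w)} : Set (archLocal L 3 (Matrix.diagonal β) w)))))
          ((archLocalTopFormHaar L 2 (Matrix.diagonal ![β 0, β 2]) w).prod (archLocalTopFormHaar L 1 (Matrix.diagonal ![β 1]) w))).IsInvInvariant :=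
        isInvInvariant_of_isHaarMeasure_centralizer_wall L β w hβ (fun i => UnitaryGroup.im_embedding_eq_zero_of_complexConj_eq L w (hhermβ i)) h02 h01 _
      ∃ (ν : Measure (archLocal L 3 (Matrix.diagonal β) w)) (_ : ν.IsHaarMeasure) (_ : ν.IsMulRightInvariant),
        ∀ (Θ : Matrix (Fin 3) (Fin 3) ℂ → ℂ), ContDiff ℝ (⊤ : ℕ∞) Θ →
            HasCompactSupport (fun k : archLocal L 3 (Matrix.diagonal β) w => Θ ((k : GL (Fin 3) ℂ) : Matrix (Fin 3) (Fin 3) ℂ)) →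
            ∀ (z₀ : Fin 3 → Circle) (h02' : z₀ 0 = z₀ 2) (h01' : z₀ 0 ≠ z₀ 1),
              Tendsto (fun ψ : ℝ => deriv (fun ψ : ℝ => (2 * Real.sin ψ : ℂ) *
                  ∫ g, Θ (((g * ⟨circleDiagonal 3 (fun i => z₀ i * Circle.exp (![(1 : ℝ), 0, -1] i * ψ)),
                    circleDiagonal_mem_archLocal_diagonal L 3 β w _⟩ * g⁻¹ : archLocal L 3 (Matrix.diagonal β) w) : GL (Fin 3) ℂ) : Matrix (Fin 3) (Fin 3) ℂ) ∂(ν)) ψ)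
                (𝓝[≠] 0)
                (𝓝 ((-((V₂ * V₁ : ℝ≥0) : ℂ)) * ∫ y, descConj (⟨circleDiagonal 3 z₀, circleDiagonal_mem_archLocal_diagonal L 3 β w z₀⟩ : archLocal L 3 (Matrix.diagonal β) w)
                  (Subgroup.centralizer ({(⟨circleDiagonal 3 z₁, circleDiagonal_mem_archLocal_diagonal L 3 β w z₁⟩ : archLocal L 3 (Matrix.diagonal β) w)} : Set (archLocal L 3 (Matrix.diagonal β) w)))
                  (forall_mem_centralizer_circleDiagonal_comm_of_wall L β w h02 h01 h02' h01')
                  (fun k : archLocal L 3 (Matrix.diagonal β) w => Θ ((k : GL (Fin 3) ℂ) : Matrix (Fin 3) (Fin 3) ℂ)) y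
                  ∂(quotientMeasure _ ((Measure.map (fun p : ↥(archLocal L 2 (Matrix.diagonal ![β 0, β 2]) w) × ↥(archLocal L 1 (Matrix.diagonal ![β 1]) w) =>
            (⟨endoEmb (starRingEnd ℂ) ((Matrix.diagonal ![β 0, β 2]).map w.1.embedding) ((Matrix.diagonal ![β 1]).map w.1.embedding)
                ((Matrix.diagonal β).map w.1.embedding) (endoForm_archLocal_diagonal L β w) p,
              endoEmb_mem_centralizer_circleDiagonal L β w h02 p⟩ : ↥(Subgroup.centralizer ({(⟨circleDiagonal 3 z₁, circleDiagonal_mem_archLocal_diagonal L 3 β w z₁⟩ : archLocal L 3 (Matrix.diagonal β) w)} : Set (archLocal L 3 (Matrix.diagonal β) w)))))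
          ((archLocalTopFormHaar L 2 (Matrix.diagonal ![β 0, β 2]) w).prod (archLocalTopFormHaar L 1 (Matrix.diagonal ![β 1]) w)))) (isClosed_coe_centralizer_singleton _) (ν)))))) :
    ArchTopFormWallCompatible L := by
  refine ⟨V₂ * V₁, mul_ne_zero hV₂ hV₁, ?_, hnc⟩
  intro i2 i2b i1 i1b i3 i3b w β hβ hhermβ z₁ h02 h01 hpos
  haveI := secondCountableTopology_archLocal L 2 (Matrix.diagonal ![β 0, β 2]) w
  haveI := secondCountableTopology_archLocal L 1 (Matrix.diagonal ![β 1]) w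
  haveI := locallyCompactSpace_archLocal L 2 (Matrix.diagonal ![β 0, β 2]) w
  haveI := locallyCompactSpace_archLocal L 1 (Matrix.diagonal ![β 1]) w
  haveI : SecondCountableTopology (unitaryGroupOfForm (starRingEnd ℂ) ((Matrix.diagonal ![β 0, β 2]).map w.1.embedding)) :=
    secondCountableTopology_archLocal L 2 (Matrix.diagonal ![β 0, β 2]) w
  haveI : SecondCountableTopology (unitaryGroupOfForm (starRingEnd ℂ) ((Matrix.diagonal ![β 1]).map w.1.embedding)) :=
    secondCountableTopology_archLocal L 1 (Matrix.diagonal ![β 1]) w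
  haveI : (archLocalTopFormHaar L 2 (Matrix.diagonal ![β 0, β 2]) w).IsHaarMeasure := isHaarMeasure_archLocalTopFormHaar_diagonal L 2 w ![β 0, β 2] (fun i => by fin_cases i <;> simp [hβ]) (fun i => by fin_cases i <;> simp [hhermβ])
  haveI : (archLocalTopFormHaar L 1 (Matrix.diagonal ![β 1]) w).IsHaarMeasure := isHaarMeasure_archLocalTopFormHaar_diagonal L 1 w ![β 1] (fun i => by fin_cases i; simp [hβ]) (fun i => by fin_cases i; simp [hhermβ])
  have hf : Measurable (fun p : ↥(archLocal L 2 (Matrix.diagonal ![β 0, β 2]) w) × ↥(archLocal L 1 (Matrix.diagonal ![β 1]) w) =>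
      (⟨endoEmb (starRingEnd ℂ) ((Matrix.diagonal ![β 0, β 2]).map w.1.embedding) ((Matrix.diagonal ![β 1]).map w.1.embedding)
          ((Matrix.diagonal β).map w.1.embedding) (endoForm_archLocal_diagonal L β w) p,
        endoEmb_mem_centralizer_circleDiagonal L β w h02 p⟩ : ↥(Subgroup.centralizer ({(⟨circleDiagonal 3 z₁, circleDiagonal_mem_archLocal_diagonal L 3 β w z₁⟩ : archLocal L 3 (Matrix.diagonal β) w)} : Set (archLocal L 3 (Matrix.diagonal β) w))))) :=
    ((continuous_endoEmb (starRingEnd ℂ) (endoForm_archLocal_diagonal L β w)).subtype_mk _).measurable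
  rw [Measure.map_apply hf MeasurableSet.univ, Set.preimage_univ, ← Set.univ_prod_univ, Measure.prod_prod,
    hm₂ w ![β 0, β 2] (fun i => by fin_cases i <;> simp [hβ]) (fun i => by fin_cases i <;> simp [hhermβ]) (by simpa using hpos),
    hm₁ w (β 1) (hβ 1) (hhermβ 1), ENNReal.coe_mul]

end Summit.HodgeConjecture.HodgeConjecture.Cruxes.H413.F0P3ArchTopFormWallCompatibleOfBlocks


/-! ## EDITION 2 (A-p19 g24, 2026-09-01) — U4 from (ii) + (W2): the compact inputs discharged by ★ p844742 `UnitaryArchLocalTopFormMassUniversal` -/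

namespace Summit.HodgeConjecture.HodgeConjecture.Cruxes.H413.F0P3ArchTopFormWallCompatibleOfBlocks

set_option maxHeartbeats 800000 in
/-- **U4 FROM (ii) AND (W2) ALONE.**  With the explicit constants `V_N := (∫⁻_{source(1_N)} w₀ dλ).toNNReal` (`N = 2, 1`; Borel σ-algebras supplied by the binders): the local identity
«top-form mass = window-free source integral» at real diagonal carriers of sizes `2` and `1` (`hii₂`, `hii₁` — U4-discharge piece (ii), A-p06 (g29)) and the (J-nc) clause of the top-form
wall-block measure with constant `−V₂·V₁` (`hnc` — CENSUS-Jval (b2)) imply `ArchTopFormWallCompatible L` (★ `blockMass_two_of_massEqSource`, ★ `blockMass_one_of_massEqSource`, ★ ED. 1).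
(in-house plumbing; motivated by Rogawski 1990 §8.2 p. 118, §1.7 p. 6) -/
theorem archTopFormWallCompatible_of_massEqSource_of_clause (L : Type) [Field L] [NumberField L] [IsCMField L]
    [MeasurableSpace (skewC 2 (Matrix.diagonal fun _ : Fin 2 => ((1 : ℝ) : ℂ)))] [BorelSpace (skewC 2 (Matrix.diagonal fun _ : Fin 2 => ((1 : ℝ) : ℂ)))] [MeasurableSpace (skewC 1 (Matrix.diagonal fun _ : Fin 1 => ((1 : ℝ) : ℂ)))] [BorelSpace (skewC 1 (Matrix.diagonal fun _ : Fin 1 => ((1 : ℝ) : ℂ)))]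
    (hii₂ : (∀ (w : {w : InfinitePlace L // IsComplex w}) (b : Fin 2 → L) (_hb : ∀ i, b i ≠ 0) (_hbr : ∀ i, (IsCMField.complexConj L (b i) : L) = b i)
      [MeasurableSpace (GL (Fin 2) ℂ)] [BorelSpace (GL (Fin 2) ℂ)]
      [MeasurableSpace (skewC 2 ((Matrix.diagonal b).map w.1.embedding))] [BorelSpace (skewC 2 ((Matrix.diagonal b).map w.1.embedding))],
      archLocalTopFormHaar L 2 (Matrix.diagonal b) w Set.univ =
        ∫⁻ X in cayleySourceC 2 ((Matrix.diagonal b).map w.1.embedding), ENNReal.ofReal (cayleyWeightC 2 ((Matrix.diagonal b).map w.1.embedding) X) ∂(lieStdLebesgueC 2 ((Matrix.diagonal b).map w.1.embedding))))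
    (hii₁ : (∀ (w : {w : InfinitePlace L // IsComplex w}) (b : Fin 1 → L) (_hb : ∀ i, b i ≠ 0) (_hbr : ∀ i, (IsCMField.complexConj L (b i) : L) = b i)
      [MeasurableSpace (GL (Fin 1) ℂ)] [BorelSpace (GL (Fin 1) ℂ)]
      [MeasurableSpace (skewC 1 ((Matrix.diagonal b).map w.1.embedding))] [BorelSpace (skewC 1 ((Matrix.diagonal b).map w.1.embedding))],
      archLocalTopFormHaar L 1 (Matrix.diagonal b) w Set.univ =
        ∫⁻ X in cayleySourceC 1 ((Matrix.diagonal b).map w.1.embedding), ENNReal.ofReal (cayleyWeightC 1 ((Matrix.diagonal b).map w.1.embedding) X) ∂(lieStdLebesgueC 1 ((Matrix.diagonal b).map w.1.embedding))))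
    (hnc : (∀ [MeasurableSpace (GL (Fin 2) ℂ)] [BorelSpace (GL (Fin 2) ℂ)] [MeasurableSpace (GL (Fin 1) ℂ)] [BorelSpace (GL (Fin 1) ℂ)]
      [MeasurableSpace (GL (Fin 3) ℂ)] [BorelSpace (GL (Fin 3) ℂ)]
      (w : {w : InfinitePlace L // IsComplex w}) (β : Fin 3 → L) (hβ : ∀ i, β i ≠ 0) (hhermβ : ∀ i, (IsCMField.complexConj L (β i) : L) = β i)
      (z₁ : Fin 3 → Circle) (h02 : z₁ 0 = z₁ 2) (h01 : z₁ 0 ≠ z₁ 1)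
      [MeasurableSpace (archLocal L 3 (Matrix.diagonal β) w ⧸ Subgroup.centralizer ({(⟨circleDiagonal 3 z₁, circleDiagonal_mem_archLocal_diagonal L 3 β w z₁⟩ : archLocal L 3 (Matrix.diagonal β) w)} : Set (archLocal L 3 (Matrix.diagonal β) w)))] [BorelSpace (archLocal L 3 (Matrix.diagonal β) w ⧸ Subgroup.centralizer ({(⟨circleDiagonal 3 z₁, circleDiagonal_mem_archLocal_diagonal L 3 β w z₁⟩ : archLocal L 3 (Matrix.diagonal β) w)} : Set (archLocal L 3 (Matrix.diagonal β) w)))],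
      (w.1.embedding (β 0)).re * (w.1.embedding (β 2)).re < 0 →
      haveI : LocallyCompactSpace (archLocal L 3 (Matrix.diagonal β) w) := locallyCompactSpace_archLocal L 3 (Matrix.diagonal β) w
      haveI : SecondCountableTopology (archLocal L 3 (Matrix.diagonal β) w) := secondCountableTopology_archLocal L 3 (Matrix.diagonal β) w
      haveI : (archLocalTopFormHaar L 2 (Matrix.diagonal ![β 0, β 2]) w).IsHaarMeasure := isHaarMeasure_archLocalTopFormHaar_diagonal L 2 w ![β 0, β 2] (fun i => by fin_cases i <;> simp [hβ]) (fun i => by fin_cases i <;> simp [hhermβ])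
      haveI : (archLocalTopFormHaar L 1 (Matrix.diagonal ![β 1]) w).IsHaarMeasure := isHaarMeasure_archLocalTopFormHaar_diagonal L 1 w ![β 1] (fun i => by fin_cases i; simp [hβ]) (fun i => by fin_cases i; simp [hhermβ])
      haveI : (Measure.map (fun p : ↥(archLocal L 2 (Matrix.diagonal ![β 0, β 2]) w) × ↥(archLocal L 1 (Matrix.diagonal ![β 1]) w) =>
            (⟨endoEmb (starRingEnd ℂ) ((Matrix.diagonal ![β 0, β 2]).map w.1.embedding) ((Matrix.diagonal ![β 1]).map w.1.embedding)
                ((Matrix.diagonal β).map w.1.embedding) (endoForm_archLocal_diagonal L β w) p,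
              endoEmb_mem_centralizer_circleDiagonal L β w h02 p⟩ : ↥(Subgroup.centralizer ({(⟨circleDiagonal 3 z₁, circleDiagonal_mem_archLocal_diagonal L 3 β w z₁⟩ : archLocal L 3 (Matrix.diagonal β) w)} : Set (archLocal L 3 (Matrix.diagonal β) w)))))
          ((archLocalTopFormHaar L 2 (Matrix.diagonal ![β 0, β 2]) w).prod (archLocalTopFormHaar L 1 (Matrix.diagonal ![β 1]) w))).IsHaarMeasure := isHaarMeasure_wallBlockMap L β w h02 h01 _ _
      haveI : (Measure.map (fun p : ↥(archLocal L 2 (Matrix.diagonal ![β 0, β 2]) w) × ↥(archLocal L 1 (Matrix.diagonal ![β 1]) w) =>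
            (⟨endoEmb (starRingEnd ℂ) ((Matrix.diagonal ![β 0, β 2]).map w.1.embedding) ((Matrix.diagonal ![β 1]).map w.1.embedding)
                ((Matrix.diagonal β).map w.1.embedding) (endoForm_archLocal_diagonal L β w) p,
              endoEmb_mem_centralizer_circleDiagonal L β w h02 p⟩ : ↥(Subgroup.centralizer ({(⟨circleDiagonal 3 z₁, circleDiagonal_mem_archLocal_diagonal L 3 β w z₁⟩ : archLocal L 3 (Matrix.diagonal β) w)} : Set (archLocal L 3 (Matrix.diagonal β) w)))))
          ((archLocalTopFormHaar L 2 (Matrix.diagonal ![β 0, β 2]) w).prod (archLocalTopFormHaar L 1 (Matrix.diagonal ![β 1]) w))).IsInvInvariant :=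
        isInvInvariant_of_isHaarMeasure_centralizer_wall L β w hβ (fun i => UnitaryGroup.im_embedding_eq_zero_of_complexConj_eq L w (hhermβ i)) h02 h01 _
      ∃ (ν : Measure (archLocal L 3 (Matrix.diagonal β) w)) (_ : ν.IsHaarMeasure) (_ : ν.IsMulRightInvariant),
        ∀ (Θ : Matrix (Fin 3) (Fin 3) ℂ → ℂ), ContDiff ℝ (⊤ : ℕ∞) Θ →
            HasCompactSupport (fun k : archLocal L 3 (Matrix.diagonal β) w => Θ ((k : GL (Fin 3) ℂ) : Matrix (Fin 3) (Fin 3) ℂ)) →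
            ∀ (z₀ : Fin 3 → Circle) (h02' : z₀ 0 = z₀ 2) (h01' : z₀ 0 ≠ z₀ 1),
              Tendsto (fun ψ : ℝ => deriv (fun ψ : ℝ => (2 * Real.sin ψ : ℂ) *
                  ∫ g, Θ (((g * ⟨circleDiagonal 3 (fun i => z₀ i * Circle.exp (![(1 : ℝ), 0, -1] i * ψ)),
                    circleDiagonal_mem_archLocal_diagonal L 3 β w _⟩ * g⁻¹ : archLocal L 3 (Matrix.diagonal β) w) : GL (Fin 3) ℂ) : Matrix (Fin 3) (Fin 3) ℂ) ∂(ν)) ψ)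
                (𝓝[≠] 0)
                (𝓝 ((-(((∫⁻ X in cayleySourceC 2 (Matrix.diagonal fun _ : Fin 2 => ((1 : ℝ) : ℂ)), ENNReal.ofReal (cayleyWeightC 2 (Matrix.diagonal fun _ : Fin 2 => ((1 : ℝ) : ℂ)) X) ∂(lieStdLebesgueC 2 (Matrix.diagonal fun _ : Fin 2 => ((1 : ℝ) : ℂ)))).toNNReal *
            (∫⁻ X in cayleySourceC 1 (Matrix.diagonal fun _ : Fin 1 => ((1 : ℝ) : ℂ)), ENNReal.ofReal (cayleyWeightC 1 (Matrix.diagonal fun _ : Fin 1 => ((1 : ℝ) : ℂ)) X) ∂(lieStdLebesgueC 1 (Matrix.diagonal fun _ : Fin 1 => ((1 : ℝ) : ℂ)))).toNNReal : ℝ≥0) : ℂ)) * ∫ y, descConj (⟨circleDiagonal 3 z₀, circleDiagonal_mem_archLocal_diagonal L 3 β w z₀⟩ : archLocal L 3 (Matrix.diagonal β) w)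
                  (Subgroup.centralizer ({(⟨circleDiagonal 3 z₁, circleDiagonal_mem_archLocal_diagonal L 3 β w z₁⟩ : archLocal L 3 (Matrix.diagonal β) w)} : Set (archLocal L 3 (Matrix.diagonal β) w)))
                  (forall_mem_centralizer_circleDiagonal_comm_of_wall L β w h02 h01 h02' h01')
                  (fun k : archLocal L 3 (Matrix.diagonal β) w => Θ ((k : GL (Fin 3) ℂ) : Matrix (Fin 3) (Fin 3) ℂ)) y
                  ∂(quotientMeasure _ ((Measure.map (fun p : ↥(archLocal L 2 (Matrix.diagonal ![β 0, β 2]) w) × ↥(archLocal L 1 (Matrix.diagonal ![β 1]) w) =>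
            (⟨endoEmb (starRingEnd ℂ) ((Matrix.diagonal ![β 0, β 2]).map w.1.embedding) ((Matrix.diagonal ![β 1]).map w.1.embedding)
                ((Matrix.diagonal β).map w.1.embedding) (endoForm_archLocal_diagonal L β w) p,
              endoEmb_mem_centralizer_circleDiagonal L β w h02 p⟩ : ↥(Subgroup.centralizer ({(⟨circleDiagonal 3 z₁, circleDiagonal_mem_archLocal_diagonal L 3 β w z₁⟩ : archLocal L 3 (Matrix.diagonal β) w)} : Set (archLocal L 3 (Matrix.diagonal β) w)))))
          ((archLocalTopFormHaar L 2 (Matrix.diagonal ![β 0, β 2]) w).prod (archLocalTopFormHaar L 1 (Matrix.diagonal ![β 1]) w)))) (isClosed_coe_centralizer_singleton _) (ν)))))) :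
    ArchTopFormWallCompatible L := by
  obtain ⟨hV₂, hm₂⟩ := blockMass_two_of_massEqSource L hii₂
  obtain ⟨hV₁, hm₁⟩ := blockMass_one_of_massEqSource L hii₁
  exact archTopFormWallCompatible_of_blockMasses_of_clause L _ _ hV₂ hV₁ hm₂ hm₁ hnc

end Summit.HodgeConjecture.HodgeConjecture.Cruxes.H413.F0P3ArchTopFormWallCompatibleOfBlocks

end
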